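import Summits.HodgeConjecture.HodgeConjecture.Theorems.Ring2HypothesesDescentAbsoluteExteriorLefschetz
import Literature.AlgebraicGeometry.Milne1999.SpecialLefschetzGroupInvariantsPowers
import Literature.AlgebraicGeometry.HodgeTheory.MotivatedClassesHodgeClassesHolds
import HarnessLib

/-!
# Ring 2 — hypotheses layer, descent axis: MILNE'S CRITERION (Prop. 4.8 / Cor. 4.7) FOR THE WHOLE TOWER
# `Hg ≤ G¹_AH ≤ G¹_mot ≤ G¹_alg ≤ S(A)` — «`G = S(A)` iff the classes `G` stabilises are LEFSCHETZ ON EVERY POWER»,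
# and §L3 of the companion («absolute Hodge ⟹ Lefschetz») ON ALL POWERS of `A`

HONEST FRAMING (page 1, verbatim the cell's standing line): **research route conditional on HC_CM; not a
corollary; Q11.4-sentence-2 already refuted in dim ≥ 3.** Nothing in this file proves a case of the Hodge conjecture that
the tree did not have; nothing discharges the binder of record b06 `Ring2.Hypotheses.AbsoluteHodgeImpliesAlgebraicAV`
(«absolute Hodge classes on complex abelian varieties are algebraic», `Ring2HypothesesDescent.lean` :73; OPEN); the binder
table's numbers do not move. `HC_CM` (`Theses.RankFourFaces.CMAbelianHodge`), `HC_AV` and row b06 do not occur in this file;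
Charles–Schnell 11.2.18 AT the abelian varieties `A^{a+1}` (`AbsoluteHodgeClassesAreAlgebraicFor`, the per-variety form of the
row) and b05's binder AT the `A^{a+1}` (`motivatedClasses ≤ algebraicClasses`, the per-variety form of
`Ring2.Hypotheses.MotivatedImpliesAlgebraicAV`) occur as CONCLUSIONS under explicit group-theoretic hypotheses on `A`.
Hodge ladder STAGE 3, `BINDER-OWNERS.md` row **b06**, seat `ring2-b06` (gen 85). Sequel of gen 84's
`Ring2HypothesesDescentAbsoluteExteriorLefschetz`, whose honest column listed «NOT obtained: `S(A^r) = S(A)` diagonally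
(Milne Cor. 4.7) Tannaka-free, whence §L3 only on `A` itself, not on its powers».

THE INPUT (Literature, same gen, `Milne1999/SpecialLefschetzGroupInvariantsPowers`): **Milne 1999 Cor. 4.5 ON EVERY POWER,
Tannaka-free** — a class on `A.X^{×(a+1)}` fixed by the Künneth families of the special Lefschetz group
`S(A) = Milne1999.specialLefschetzGroup (dim A) A.X` is a Lefschetz class (`mem_lefschetzPowClasses_of_forall_kunnethFamily_apply_eq`,
through the Milne lane's Cor. 4.7 on `H¹` and its Thm. 3.2 / Cor. 4.5 in `S(·)(ℂ)`-form on `A^{a+1}`), whence for ANY system `T`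
of classes on the powers **`S(A) ≤ Stab(T) ⟺ T ⊆ Lefschetz`** (`specialLefschetzGroup_le_powClassStabilizer_iff`) and, for the
Hodge system, Milne's Prop. 4.8 (a) ⟺ (c) in full.

* §1 **«ABSOLUTE HODGE ⟹ LEFSCHETZ» ON ALL POWERS ⟺ `S(A) ≤ G¹_AH(A)`** — FACT-FREE
  (`specialLefschetzGroup_le_absoluteHodgeStabilizer_iff`; gen 84's §L3 had `⟸` and, for `⟹`, only the power `a = 0`):
  under `S(A) ≤ G¹_AH(A)` every absolute Hodge class on every power `A^{a+1}` is a Lefschetz class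
  (`mem_lefschetzPowClasses_of_isAbsoluteHodgeClass_of_le`), hence **Charles–Schnell 11.2.18 holds for every power `A^{a+1}`**
  (`absoluteHodgeClassesAreAlgebraicFor_cartesianPow_of_specialLefschetzGroup_le`, `…_powSucc_…`), in particular under
  Milne's condition (c) `Hg′(A) = S(A)` (`absoluteHodgeClassesAreAlgebraicFor_powSucc_of_hodgeGroup_eq_specialLefschetzGroup`) —
  all WITHOUT Deligne's Main Theorem; and `G¹_AH(A) = S(A) ⟺` the same (mod V-B3 = c23 for `G¹_AH ≤ S(A)`).
* §2 **`G¹_mot(A) = S(A) ⟺ EVERY MOTIVATED CLASS ON EVERY POWER OF `A` IS A LEFSCHETZ CLASS`** — FACT-FREE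
  (`specialMotivatedGaloisGroup_eq_specialLefschetzGroup_iff`; `G¹_mot ≤ S(A)` is typer 2's + gen 84's
  `specialMotivatedGaloisGroup_le_algebraicStabilizer`, `algebraicStabilizer_le_specialLefschetzGroup`): the `S(A)`-side twin of
  the Literature's «Hodge ⟹ motivated ⟺ `Hg = G¹_mot`» (`hodgeGroup_eq_specialMotivatedGaloisGroup_of_forall_mem_motivatedClasses`)
  and of André's record `Andre1996_specialMotivatedGaloisGroup_invariants_le` (here the `S(A)` side is a THEOREM). Consequence:
  **for every `A` with `G¹_mot(A) = S(A)`, b05's binder holds AT `A` AND AT ALL ITS POWERS** — motivated classes on `A^{a+1}` are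
  algebraic (`motivatedClasses_le_algebraicClasses_powSucc_of_specialMotivatedGaloisGroup_eq`), fact-free.
* §3 **`G¹_alg(A) = S(A) ⟺ EVERY ALGEBRAIC CLASS ON EVERY POWER OF `A` IS A LEFSCHETZ CLASS`** — FACT-FREE
  (`algebraicStabilizer_eq_specialLefschetzGroup_iff`): the stabiliser of the algebraic classes (typer 2's `algebraicStabilizer`,
  the `ℂ`-points of the motivic Galois group of `⟨h(A)⟩` for homological motives, see its docstring) IS Milne's `S(A)` exactly
  when the algebraic classes of the powers are spanned by intersections of divisors (it is strictly smaller for, e.g., the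
  Weil-type fourfolds with ALGEBRAIC exceptional classes of Schoen / van Geemen — a remark, not formalised).
* §4 **THE COLLAPSE UNDER MILNE'S (c)**: `Hg′(A) = S(A)` ⟹ `Hg(A) = G¹_AH(A) = G¹_mot(A) = G¹_alg(A) = S(A)`
  (`tower_eq_of_hodgeGroup_eq_specialLefschetzGroup`, fact-free; the `G¹_AH` link too, since `Hg ≤ G¹_AH` is fact-free and
  `G¹_AH ≤ S` follows from §1) — the Tannaka-free form of «no exotic Hodge class on any power ⟹ every Hodge / absolute Hodge /
  motivated / algebraic class on every power is Lefschetz».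

HONEST COLUMN. Nothing is discharged; «10 · 0» unchanged; no hypothesis of the cell occurs; V-B3 = c23
`deligne1982_cycleClass_absoluteHodge` is displayed as `hZ` exactly once (§1, the `=` form, for `G¹_AH ≤ G¹_alg`). No definition
(the absolute Hodge system and its stabiliser are INLINE, as in gens 81/84), no new named fact, no sorry. Mod c1
(`G¹_AH(A) = Hg(A)`, gen 81) the hypothesis `S(A) ≤ G¹_AH(A)` of §1 IS Milne's (c), under which HC holds on all powers anyway
(Literature, same gen, `hodgeConjectureFor_powSucc_of_hodgeGroup_eq_specialLefschetzGroup`) — NO NEW CASE of the row is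
claimed; new are the EXACT group-theoretic prices on all powers for the four groups of the tower, and b05's binder at the powers
of `A` from `G¹_mot(A) = S(A)`. NOT obtained: the equality `S(A^{a+1}) = S(A)` of the Tannaka-free groups themselves (needs
«`S(A)` acts through `H¹`», i.e. injectivity of `g ↦ g₁` on `specialLefschetzGroup`, which the tree has only for
`G¹_alg ⊇ G¹_mot ⊇ G¹_AH`); anything deciding the row.

PRESEARCH. «Lefschetz group equals Hodge group / motivic Galois group iff no exotic classes on powers; stably nondegenerate»
→ [corpus: paper:doi-10-1215-s0012-7094-99-09620-5 (Milne 1999 Duke) Cor. 4.5, Cor. 4.7 (p. 659), Prop. 4.8 with proof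
(p. 660), re-read this session at the held pages p0021–p0022]; corpus hybrid «Lefschetz group abelian variety powers exotic
Hodge classes stably nondegenerate» → Green–Griffiths–Kerr (Mumford–Tate groups), Voisin II, Kerr–Pearlstein (eds.), GMV LNM
1594 — the Hodge-group side only; galaxy all stars «Lefschetz group|exotic Hodge class|stably nondegenerate» → Lange
(Grundlehren), Kerr–Pearlstein; nothing pricing `G¹_mot = S(A)` / `G¹_AH = S(A)` by Lefschetz classes on the powers beyond the
Tannakian folklore; certification by assembly on the tree's carriers, no novelty claimed. References (bib keys):
Milne1999LefschetzClasses (§4 Def. 4.3, Thm. 4.4, Cor. 4.5, Cor. 4.7, Prop. 4.8, Rem. 4.9), Andre1996Motifs (§4.6 (ii), Prop.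
2.5.1, §6.2), Deligne1982HodgeCycles (I §3, §2 Ex. 2.1 (a)), CharlesSchnell2014Notes (§11.2.5 (11.2.18)),
Gordon1999HodgeAVSurvey (Thm. 7.5, Def. 7.6), vanGeemen1994HodgeAV (§2.4–2.5), Schoen1988HodgeWeil (algebraic Weil classes).
-/

noncomputable section

-- every declaration of this problem lives in `Summit.HodgeConjecture.HodgeConjecture.…` (summit = sub-problem)
set_option linter.dupNamespace false

namespace Summit.HodgeConjecture.HodgeConjecture.Ring2.Hypotheses

open CategoryTheory AlgebraicGeometry MonoidalCategory CartesianMonoidalCategory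
open Literature.AlgebraicGeometry Literature.AlgebraicGeometry.Motives
open Literature.AlgebraicGeometry.HodgeTheory
open Literature.AlgebraicTopology.SingularHomology
open Literature.Barriers.HodgeConjecture (divisorClassesSpan)
open Literature.AlgebraicGeometry.Milne1999 (specialLefschetzGroup lefschetzPowClasses
  specialLefschetzGroup_le_powClassStabilizer_iff powClassStabilizer_eq_specialLefschetzGroup_iff)

/-! ## §0 Transport between the abelian variety `A^{a+1}` and the scheme power `A.X^{×(a+1)}` -/

section Transport

/-- `AbsoluteHodgeClassesAreAlgebraicFor` along an identification of the scheme and of the dimension (private plumbing,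
by `subst`; used with `AbelianVariety.powSucc_X_eq_cartesianPow`, `…dim_powSucc_eq_cartesianPowDim`). [folklore] -/
private theorem absoluteHodgeClassesAreAlgebraicFor_iff_of_eq {Y Y' : SchemeOver ℂ} (e : Y = Y') {N N' : ℕ}
    (hN : N = N') : AbsoluteHodgeClassesAreAlgebraicFor N Y ↔ AbsoluteHodgeClassesAreAlgebraicFor N' Y' := by
  subst e hN
  exact Iff.rfl

/-- `motivatedClasses ≤ algebraicClasses` along an identification of the scheme and of the dimension (private plumbing,
by `subst`). [folklore] -/
private theorem motivatedClasses_le_algebraicClasses_iff_of_eq {Y Y' : SchemeOver ℂ} (e : Y = Y') {N N' : ℕ}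
    (hN : N = N') (p : ℕ) :
    motivatedClasses N Y p ≤ algebraicClasses Y p ↔ motivatedClasses N' Y' p ≤ algebraicClasses Y' p := by
  subst e hN
  exact Iff.rfl

end Transport

/-! ## §1 «Absolute Hodge ⟹ Lefschetz» on all powers ⟺ `S(A) ≤ G¹_AH(A)`; 11.2.18 on every power -/

section AbsoluteHodge

variable (A : AbelianVariety ℂ)

/-- **`S(A) ≤ G¹_AH(A)` ⟺ every absolute Hodge class on every power `A.X^{×(a+1)}` is a Lefschetz class** — FACT-FREE
(Milne Cor. 4.5 on all powers, Tannaka-free, with `T` = the absolute Hodge system; `⟸` is gen 84's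
`specialLefschetzGroup_le_absoluteHodgeStabilizer_of_forall_subset`). The AH twin of Milne's Prop. 4.8 (a) ⟺ (c), and mod c1
(`G¹_AH = Hg`) literally it. [cite: Milne1999LefschetzClasses, Cor. 4.5 (p. 659) and Prop. 4.8 (p. 660)]
[cite: Deligne1982HodgeCycles, I §3 Thm. 3.8] -/
theorem specialLefschetzGroup_le_absoluteHodgeStabilizer_iff :
    specialLefschetzGroup A.dim A.X ≤ powClassStabilizer A.X (fun a p ↦
      {c : complexBetti (cartesianPow A.X (a + 1)) (2 * p) |
        IsAbsoluteHodgeClass (cartesianPowDim A.dim a) (cartesianPow A.X (a + 1)) p c}) ↔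
      ∀ a p, {c : complexBetti (cartesianPow A.X (a + 1)) (2 * p) |
        IsAbsoluteHodgeClass (cartesianPowDim A.dim a) (cartesianPow A.X (a + 1)) p c} ⊆ lefschetzPowClasses A.dim A.X a p :=
  specialLefschetzGroup_le_powClassStabilizer_iff A _

variable {A} in
/-- **Under `S(A) ≤ G¹_AH(A)`, every absolute Hodge class on EVERY POWER `A.X^{×(a+1)}` is a Lefschetz class**
(`D^p_hom(A^{a+1})_ℂ`) — FACT-FREE; gen 84's `mem_divisorClassesSpan_of_isAbsoluteHodgeClass_of_le` is the power `a = 0`.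
[cite: Milne1999LefschetzClasses, Cor. 4.5 and Cor. 4.7 (p. 659)] [cite: Deligne1982HodgeCycles, I §3 Thm. 3.8] -/
theorem mem_lefschetzPowClasses_of_isAbsoluteHodgeClass_of_le
    (hle : specialLefschetzGroup A.dim A.X ≤ powClassStabilizer A.X (fun a p ↦
      {c : complexBetti (cartesianPow A.X (a + 1)) (2 * p) |
        IsAbsoluteHodgeClass (cartesianPowDim A.dim a) (cartesianPow A.X (a + 1)) p c}))
    {a p : ℕ} {c : complexBetti (cartesianPow A.X (a + 1)) (2 * p)}
    (hc : IsAbsoluteHodgeClass (cartesianPowDim A.dim a) (cartesianPow A.X (a + 1)) p c) :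
    c ∈ lefschetzPowClasses A.dim A.X a p :=
  (specialLefschetzGroup_le_absoluteHodgeStabilizer_iff A).1 hle a p hc

variable {A} in
/-- **`S(A) ≤ G¹_AH(A)` ⟹ Charles–Schnell 11.2.18 for EVERY POWER `A.X^{×(a+1)}`** (`AbsoluteHodgeClassesAreAlgebraicFor`:
every absolute Hodge class there is algebraic) — FACT-FREE: such a class is Lefschetz (previous theorem) and Lefschetz classes
of a power of an abelian variety are algebraic (gen 84's `lefschetzPowClasses_subset_algebraicPowClasses`: Lefschetz `(1,1)` and
cup products with divisor classes, the tree's theorems); the Hodge-model conjunct is `nonempty_hodgeModel_holds` on the power.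
Gen 84's `absoluteHodgeClassesAreAlgebraicFor_of_specialLefschetzGroup_le` is the power `a = 0`.
[cite: Milne1999LefschetzClasses, Cor. 4.5 and Cor. 4.7 (p. 659)] [cite: CharlesSchnell2014Notes, §11.2.5 (11.2.18)]
[cite: VoisinHodgeI2002, Thm. 11.30] -/
theorem absoluteHodgeClassesAreAlgebraicFor_cartesianPow_of_specialLefschetzGroup_le
    (hle : specialLefschetzGroup A.dim A.X ≤ powClassStabilizer A.X (fun a p ↦
      {c : complexBetti (cartesianPow A.X (a + 1)) (2 * p) |
        IsAbsoluteHodgeClass (cartesianPowDim A.dim a) (cartesianPow A.X (a + 1)) p c}))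
    (a : ℕ) : AbsoluteHodgeClassesAreAlgebraicFor (cartesianPowDim A.dim a) (cartesianPow A.X (a + 1)) :=
  ⟨nonempty_hodgeModel_holds (isSmoothProjective_cartesianPow (AbelianVariety.isSmoothProjective_holds (A := A)) a),
    fun p _ hc ↦ lefschetzPowClasses_subset_algebraicPowClasses A a p
      (mem_lefschetzPowClasses_of_isAbsoluteHodgeClass_of_le hle hc)⟩

variable {A} in
/-- The same for the abelian variety `A^{a+1} = A.powSucc a` on the nose (its scheme IS `A.X^{×(a+1)}` and its dimension IS
`cartesianPowDim (dim A) a`): **`S(A) ≤ G¹_AH(A)` ⟹ 11.2.18 for every `A^{a+1}`** — the per-variety form of row b06 at all powers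
of `A`, FACT-FREE. [cite: Milne1999LefschetzClasses, Cor. 4.5 and Cor. 4.7 (p. 659)] [cite: CharlesSchnell2014Notes, §11.2.5 (11.2.18)] -/
theorem absoluteHodgeClassesAreAlgebraicFor_powSucc_of_specialLefschetzGroup_le
    (hle : specialLefschetzGroup A.dim A.X ≤ powClassStabilizer A.X (fun a p ↦
      {c : complexBetti (cartesianPow A.X (a + 1)) (2 * p) |
        IsAbsoluteHodgeClass (cartesianPowDim A.dim a) (cartesianPow A.X (a + 1)) p c}))
    (a : ℕ) : AbsoluteHodgeClassesAreAlgebraicFor (A.powSucc a).dim (A.powSucc a).X :=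
  (absoluteHodgeClassesAreAlgebraicFor_iff_of_eq (A.powSucc_X_eq_cartesianPow a) (A.dim_powSucc_eq_cartesianPowDim a)).2
    (absoluteHodgeClassesAreAlgebraicFor_cartesianPow_of_specialLefschetzGroup_le hle a)

/-- **Milne's condition (c) `Hg′(A) = S(A)` gives 11.2.18 for EVERY POWER `A^{a+1}` WITHOUT Deligne's Main Theorem** — FACT-FREE
(`S(A) = Hg(A) ≤ G¹_AH(A)`, gen 81's `hodgeGroup_le_absoluteHodgeStabilizer`); gen 84's
`absoluteHodgeClassesAreAlgebraicFor_of_hodgeGroup_eq_specialLefschetzGroup` is the power `a = 0`. (Under (c) every power of `A`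
satisfies HC — Literature, same gen, `Milne1999.hodgeConjectureFor_powSucc_of_hodgeGroup_eq_specialLefschetzGroup` — so this is
the AH twin of a known case, not a new case of the row.) [cite: Milne1999LefschetzClasses, Prop. 4.8 (p. 660)]
[cite: CharlesSchnell2014Notes, §11.2.5 (11.2.18)] -/
theorem absoluteHodgeClassesAreAlgebraicFor_powSucc_of_hodgeGroup_eq_specialLefschetzGroup
    (h : hodgeGroup A.dim A.X = specialLefschetzGroup A.dim A.X) (a : ℕ) :
    AbsoluteHodgeClassesAreAlgebraicFor (A.powSucc a).dim (A.powSucc a).X :=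
  absoluteHodgeClassesAreAlgebraicFor_powSucc_of_specialLefschetzGroup_le (h ▸ hodgeGroup_le_absoluteHodgeStabilizer) a

/-- **`G¹_AH(A) = S(A)` ⟺ every absolute Hodge class on every power of `A` is a Lefschetz class** (mod V-B3 = c23, displayed,
for `G¹_AH(A) ≤ G¹_alg(A) ≤ S(A)`): the absolute Hodge row of MILNE'S CRITERION for the tower.
[cite: Milne1999LefschetzClasses, Prop. 4.8 (p. 660)] [cite: Deligne1982HodgeCycles, §2 Example 2.1 (a) and I §3 Thm. 3.8] -/
theorem absoluteHodgeStabilizer_eq_specialLefschetzGroup_iff (hZ : deligne1982_cycleClass_absoluteHodge) :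
    powClassStabilizer A.X (fun a p ↦
      {c : complexBetti (cartesianPow A.X (a + 1)) (2 * p) |
        IsAbsoluteHodgeClass (cartesianPowDim A.dim a) (cartesianPow A.X (a + 1)) p c}) = specialLefschetzGroup A.dim A.X ↔
      ∀ a p, {c : complexBetti (cartesianPow A.X (a + 1)) (2 * p) |
        IsAbsoluteHodgeClass (cartesianPowDim A.dim a) (cartesianPow A.X (a + 1)) p c} ⊆ lefschetzPowClasses A.dim A.X a p :=
  powClassStabilizer_eq_specialLefschetzGroup_iff A
    ((absoluteHodgeStabilizer_le_algebraicStabilizer hZ AbelianVariety.isSmoothProjective_holds).trans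
      (algebraicStabilizer_le_specialLefschetzGroup A))

end AbsoluteHodge

/-! ## §2 `G¹_mot(A) = S(A)` ⟺ every motivated class on every power is Lefschetz; b05's binder at the powers of `A` -/

section Motivated

variable (A : AbelianVariety ℂ)

/-- **`G¹_mot(A) ≤ S(A)`** — FACT-FREE (typer 2's `specialMotivatedGaloisGroup_le_algebraicStabilizer` with gen 84's
`algebraicStabilizer_le_specialLefschetzGroup`: Lefschetz classes on the powers are algebraic, algebraic classes are motivated).
[cite: Andre1996Motifs, §4.6 (ii) (p. 24)] [cite: Milne1999LefschetzClasses, §4 p. 660 (`L(A) ⊃ Hg(A)`)] -/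
theorem specialMotivatedGaloisGroup_le_specialLefschetzGroup :
    specialMotivatedGaloisGroup A.dim A.X ≤ specialLefschetzGroup A.dim A.X :=
  (specialMotivatedGaloisGroup_le_algebraicStabilizer AbelianVariety.isSmoothProjective_holds).trans
    (algebraicStabilizer_le_specialLefschetzGroup A)

/-- **MILNE'S CRITERION FOR ANDRÉ'S GROUP: `G¹_mot(A) = S(A)` ⟺ every motivated class on every power `A.X^{×(a+1)}` is a
Lefschetz class** — FACT-FREE (Cor. 4.5 on all powers, Tannaka-free, with `T` = the motivated system `motivatedPowClasses`;
`G¹_mot ≤ S` by the previous theorem). The `S(A)`-side twin of the Literature's «Hodge ⟹ motivated on all powers ⟺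
`Hg(X) = G¹_mot(X)`» (`hodgeGroup_eq_specialMotivatedGaloisGroup_of_forall_mem_motivatedClasses`).
[cite: Milne1999LefschetzClasses, Cor. 4.5 (p. 659) and Prop. 4.8 (p. 660)] [cite: Andre1996Motifs, §4.6 (ii) (p. 24) and §6.2 (p. 31)] -/
theorem specialMotivatedGaloisGroup_eq_specialLefschetzGroup_iff :
    specialMotivatedGaloisGroup A.dim A.X = specialLefschetzGroup A.dim A.X ↔
      ∀ a p, motivatedPowClasses A.dim A.X a p ⊆ lefschetzPowClasses A.dim A.X a p := by
  rw [specialMotivatedGaloisGroup]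
  exact powClassStabilizer_eq_specialLefschetzGroup_iff A (specialMotivatedGaloisGroup_le_specialLefschetzGroup A)

variable {A} in
/-- **Under `G¹_mot(A) = S(A)`, every motivated class on every power `A.X^{×(a+1)}` is algebraic** — FACT-FREE (it is Lefschetz,
and Lefschetz classes of the powers are algebraic, gen 84's `lefschetzPowClasses_subset_algebraicPowClasses`).
[cite: Milne1999LefschetzClasses, Cor. 4.5 and Cor. 4.7 (p. 659)] [cite: Andre1996Motifs, §4.6 (ii) (p. 24)] -/
theorem motivatedPowClasses_subset_algebraicPowClasses_of_specialMotivatedGaloisGroup_eq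
    (h : specialMotivatedGaloisGroup A.dim A.X = specialLefschetzGroup A.dim A.X) (a p : ℕ) :
    motivatedPowClasses A.dim A.X a p ⊆ algebraicPowClasses A.X a p :=
  fun _ hc ↦ lefschetzPowClasses_subset_algebraicPowClasses A a p
    ((specialMotivatedGaloisGroup_eq_specialLefschetzGroup_iff A).1 h a p hc)

variable {A} in
/-- **b05's binder AT `A` AND AT ALL ITS POWERS from Milne's criterion for André's group**: if `G¹_mot(A) = S(A)` then for
every `a` the motivated classes of the abelian variety `A^{a+1} = A.powSucc a` are algebraic,
`motivatedClasses (dim A^{a+1}) (A^{a+1}).X p ≤ algebraicClasses (A^{a+1}).X p` — the per-variety form of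
`Ring2.Hypotheses.MotivatedImpliesAlgebraicAV` at the powers of `A`, FACT-FREE. [cite: Milne1999LefschetzClasses, Cor. 4.5, Cor. 4.7, Prop. 4.8 (pp. 659–660)]
[cite: Andre1996Motifs, §4.6 (ii) (p. 24)] -/
theorem motivatedClasses_le_algebraicClasses_powSucc_of_specialMotivatedGaloisGroup_eq
    (h : specialMotivatedGaloisGroup A.dim A.X = specialLefschetzGroup A.dim A.X) (a p : ℕ) :
    motivatedClasses (A.powSucc a).dim (A.powSucc a).X p ≤ algebraicClasses (A.powSucc a).X p :=
  (motivatedClasses_le_algebraicClasses_iff_of_eq (A.powSucc_X_eq_cartesianPow a) (A.dim_powSucc_eq_cartesianPowDim a) p).2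
    fun _ hc ↦ motivatedPowClasses_subset_algebraicPowClasses_of_specialMotivatedGaloisGroup_eq h a p hc

end Motivated

/-! ## §3 `G¹_alg(A) = S(A)` ⟺ every algebraic class on every power is Lefschetz -/

section Algebraic

variable (A : AbelianVariety ℂ)

/-- **MILNE'S CRITERION FOR THE ALGEBRAIC STABILISER: `G¹_alg(A) = S(A)` ⟺ every algebraic class on every power
`A.X^{×(a+1)}` is a Lefschetz class** (an intersection of divisor classes, `ℂ`-linearly) — FACT-FREE (Cor. 4.5 on all powers,
Tannaka-free, with `T` = the algebraic system; `G¹_alg ≤ S` is gen 84's `algebraicStabilizer_le_specialLefschetzGroup`).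
[cite: Milne1999LefschetzClasses, Cor. 4.5 (p. 659) and Prop. 4.8 (p. 660)] [cite: Andre1996Motifs, §4.6 (ii) (p. 24)] -/
theorem algebraicStabilizer_eq_specialLefschetzGroup_iff :
    algebraicStabilizer A.X = specialLefschetzGroup A.dim A.X ↔
      ∀ a p, algebraicPowClasses A.X a p ⊆ lefschetzPowClasses A.dim A.X a p :=
  powClassStabilizer_eq_specialLefschetzGroup_iff A (algebraicStabilizer_le_specialLefschetzGroup A)

/-- Contrapositive reading: **an algebraic class on some power of `A` that is NOT a Lefschetz class forces `G¹_alg(A) < S(A)`**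
(strict inclusion of the algebraic stabiliser in Milne's group). [cite: Milne1999LefschetzClasses, Prop. 4.8 and Remark 4.9 (p. 660)] -/
theorem algebraicStabilizer_lt_specialLefschetzGroup_of_not_mem {a p : ℕ} {c : complexBetti (cartesianPow A.X (a + 1)) (2 * p)}
    (hc : c ∈ algebraicPowClasses A.X a p) (hnot : c ∉ lefschetzPowClasses A.dim A.X a p) :
    algebraicStabilizer A.X < specialLefschetzGroup A.dim A.X := by
  refine lt_of_le_of_ne (algebraicStabilizer_le_specialLefschetzGroup A) fun h ↦ hnot ?_
  exact (algebraicStabilizer_eq_specialLefschetzGroup_iff A).1 h a p hc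

end Algebraic

/-! ## §4 The collapse of the tower under Milne's (c) -/

section Collapse

variable (A : AbelianVariety ℂ)

/-- **Under Milne's (c) `Hg′(A) = S(A)` the whole tower collapses: `G¹_mot(A) = S(A)` and `G¹_alg(A) = S(A)`** — FACT-FREE
(`Hg ≤ G¹_mot ≤ G¹_alg ≤ S = Hg`: the Literature's `hodgeGroup_le_specialMotivatedGaloisGroup_holds`, typer 2's
`specialMotivatedGaloisGroup_le_algebraicStabilizer`, gen 84's `algebraicStabilizer_le_specialLefschetzGroup`); equivalently (§2–§3)
every motivated and every algebraic class on every power of `A` is Lefschetz.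
[cite: Milne1999LefschetzClasses, Prop. 4.8 (p. 660)] [cite: Andre1996Motifs, §6.2 (p. 31)] -/
theorem tower_eq_of_hodgeGroup_eq_specialLefschetzGroup (h : hodgeGroup A.dim A.X = specialLefschetzGroup A.dim A.X) :
    specialMotivatedGaloisGroup A.dim A.X = specialLefschetzGroup A.dim A.X ∧
      algebraicStabilizer A.X = specialLefschetzGroup A.dim A.X := by
  have hX : IsSmoothProjective A.dim A.X := AbelianVariety.isSmoothProjective_holds (A := A)
  have h1 : specialLefschetzGroup A.dim A.X ≤ specialMotivatedGaloisGroup A.dim A.X :=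
    h.ge.trans (hodgeGroup_le_specialMotivatedGaloisGroup_holds hX)
  exact ⟨le_antisymm (specialMotivatedGaloisGroup_le_specialLefschetzGroup A) h1,
    le_antisymm (algebraicStabilizer_le_specialLefschetzGroup A)
      (h1.trans (specialMotivatedGaloisGroup_le_algebraicStabilizer hX))⟩

/-- **Under Milne's (c), `S(A) ≤ G¹_AH(A)` and every absolute Hodge class on every power of `A` is a Lefschetz class** —
FACT-FREE (`S = Hg ≤ G¹_AH` by gen 81's `hodgeGroup_le_absoluteHodgeStabilizer`, then §1). (The reverse inclusion `G¹_AH ≤ S`,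
i.e. «Lefschetz classes are absolute Hodge», is where V-B3 = c23 enters: next theorem.)
[cite: Milne1999LefschetzClasses, Prop. 4.8 (p. 660)] [cite: Deligne1982HodgeCycles, I §3 Thm. 3.8] -/
theorem specialLefschetzGroup_le_absoluteHodgeStabilizer_of_hodgeGroup_eq
    (h : hodgeGroup A.dim A.X = specialLefschetzGroup A.dim A.X) :
    specialLefschetzGroup A.dim A.X ≤ powClassStabilizer A.X (fun a p ↦
      {c : complexBetti (cartesianPow A.X (a + 1)) (2 * p) |
        IsAbsoluteHodgeClass (cartesianPowDim A.dim a) (cartesianPow A.X (a + 1)) p c}) ∧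
      ∀ a p, {c : complexBetti (cartesianPow A.X (a + 1)) (2 * p) |
        IsAbsoluteHodgeClass (cartesianPowDim A.dim a) (cartesianPow A.X (a + 1)) p c} ⊆ lefschetzPowClasses A.dim A.X a p :=
  have hle := h ▸ (hodgeGroup_le_absoluteHodgeStabilizer (n := A.dim) (X := A.X))
  ⟨hle, (specialLefschetzGroup_le_absoluteHodgeStabilizer_iff A).1 hle⟩

/-- **Under Milne's (c), `G¹_AH(A) = S(A)`** (mod V-B3 = c23, displayed, for `G¹_AH ≤ G¹_alg ≤ S`): with the previous two
theorems, `Hg(A) = G¹_AH(A) = G¹_mot(A) = G¹_alg(A) = S(A)`. [cite: Milne1999LefschetzClasses, Prop. 4.8 (p. 660)]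
[cite: Deligne1982HodgeCycles, §2 Example 2.1 (a) and I §3 Thm. 3.8] -/
theorem absoluteHodgeStabilizer_eq_specialLefschetzGroup_of_hodgeGroup_eq (hZ : deligne1982_cycleClass_absoluteHodge)
    (h : hodgeGroup A.dim A.X = specialLefschetzGroup A.dim A.X) :
    powClassStabilizer A.X (fun a p ↦
      {c : complexBetti (cartesianPow A.X (a + 1)) (2 * p) |
        IsAbsoluteHodgeClass (cartesianPowDim A.dim a) (cartesianPow A.X (a + 1)) p c}) = specialLefschetzGroup A.dim A.X :=
  (absoluteHodgeStabilizer_eq_specialLefschetzGroup_iff A hZ).2 (specialLefschetzGroup_le_absoluteHodgeStabilizer_of_hodgeGroup_eq A h).2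

end Collapse

end Summit.HodgeConjecture.HodgeConjecture.Ring2.Hypotheses

end
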